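import Summits.ABC.ABC.Theorems.FeketeScalesTargetOfSubPowerSlack
import Summits.ABC.ABC.Theorems.FeketeScalesSubmultOfRSTBridge

/-!
# Route FeketeScales — the crux `Target` (stmt-ABC-2159) below Robert–Stewart–Tenenbaum's Conjecture A

Upward anchor of every line of `Cruxes/Target/`: the OPEN conjecture
`Literature.Barriers.ABC.RSTConjectureAUpper` (Robert–Stewart–Tenenbaum 2014, Conjecture A, upper half
(1·5): `c < k exp(4√(3 log k/log₂ k)(1 + …))`, `k = rad(abc)`) implies the crux `Target` of route
`FeketeScales` — RST gives the sub-power slack with `τ = 1/2` (`SubmultOfRST.subpowerSlack_of_rstConjectureAUpper`,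
file `FeketeScalesSubmultOfRSTBridge.lean`), and the slack gives `Target`
(`Target.target_of_subPowerSlack`).  CONDITIONAL on the open conjecture, taken as a hypothesis; kept in
its own file so that the route's cone does not import the barrier catalogue.  Calibration value: the
crux, although stronger than `ABC` (it implies `ABC` through the route's `Assembly`), is implied by the
standard refined abc conjecture.  `--supports stmt-ABC-2159`; closes nothing.
-/

-- `Summit.<Summit>.<Problem>` is the mandated summit-side namespace (CONVENTIONS §2); for the
-- single-conjunct summit `ABC` the two coincide, so the duplicate `ABC.ABC` is deliberate.
set_option linter.dupNamespace false

namespace Summit.ABC.ABC.Theorems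

open Literature.Barriers.ABC

/-- **RST Conjecture A (upper half) implies the crux `Target`** of route `FeketeScales`
(stmt-ABC-2159), conditional on the open conjecture `RSTConjectureAUpper` taken as a hypothesis:
`RSTConjectureAUpper → (sub-power slack, τ = 1/2) → Target`.
[cite: RobertStewartTenenbaum2014, Conjecture A (1.5), §1 p. 1157] -/
theorem Target.target_of_rstConjectureAUpper (h : RSTConjectureAUpper) :
    Summit.ABC.ABC.Theses.FeketeScales.Target :=
  Target.target_of_subPowerSlack (SubmultOfRST.subpowerSlack_of_rstConjectureAUpper h)

end Summit.ABC.ABC.Theorems
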